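import Summits.QuantumFields.BalabanUV.Beta.FP.TowerDoorGaugeRefDefsG
import Summits.QuantumFields.BalabanUV.Beta.FP.TowerDoorGaugeBound

/-!
# `BalabanUV.Beta.FP.TowerDoorGaugeBoundG` — row D1 ∕ (C1) OWNER «beta-an2», PART 83, ROUTE T (β1), v11 (R-root): **PART 59 `TowerDoorGaugeBound` OVER `Q`** — the lattice gauge
# function `lamZG Lc Q …` (PART 81) is bounded by the column and exponentially localised at the source block for every decaying chart, with the three summability corollaries, and the
# record's chart `scaleK σ σ (AN R (n+1))` instance hypothesis-free — PART 59 §2–§3 line for line with `lamZ ↦ lamZG Lc Q`, `refSlice ∕ refTheta ↦ refSliceG ∕ refThetaG Lc Q`; PART 59 §1's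
# generic bounds (`abs_mulVec_apply_le ∕ abs_readout_mulVec_le ∕ l1_sub_le_of_mem_pbox ∕ l1_zsmul_sub_le`) and `decays_scaleK_AN` are row-free and REUSED by name
# (β-function cell `pub-balaban`, BINDER-OWNERS row D1; FINDING AN2-82-1, road A-4 l.69064 «GO on ONE GENERIC EDITION»)

WHY (located).  Under (R-root) the door's gauge function is `lamZG` at the centred rooted family (PART 80∕81); PART 69′ ∕ the road's R4a′∕R4b′ ∕ PART 74′ read PART 59's bounds BY NAME
— here they are over `Q` (no row-family fact is spent: the bounds are finite-dimensional, `K` = the entry sum of the reference read-out operator, whatever `Q`).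

WHAT ([folklore] BY NAME; no `def`, no `def … : Prop`, nothing cited, 0 sorry): §1 `exists_abs_lamZG_le_sum`, `exists_abs_lamZG_le_exp`, `exists_abs_lamZG_le`, `summable_abs_lamZG_sites`,
`summable_abs_lamZG_sources`, `exists_tsum_abs_lamZG_sources_le`; §2 the record's chart: `exists_abs_lamZG_record_le_exp`, `summable_abs_lamZG_record_sites ∕ _sources`,
`exists_tsum_abs_lamZG_record_sources_le`.  The sym instance `Q := QSym Lc` recovers PART 59 by `rfl` (`lamZG_QSym`).
WHAT THIS IS NOT: nothing of v10 ∕ the END of record moves; nothing of Bałaban's asserted, valued or discharged; 0 estimates beyond [folklore] finite bounds; 0∕4 row-D1 binders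
(hW, hR, D1Tel, D1Rep); ROOT M‴ p325680 ∕ P5c ∕ D6 untouched; NOT (C1), NOT (T-ID), NOT D1, NEVER «G-an2-4 closed», NOT BetaPertH, NOT continuum, NOT Clay.

HONEST DEPENDENCY (page 1, mandatory): continuum YM on T⁴ ⇐ BetaPertH ∧ nine spine estimates (0/9 proved); BetaPertH ⇐ (D1) ∧ (D4) ∧ CAP+tail;
G-an2-4 gates asym, D1 and NE2/3/4.  HONEST FRAMING (cell contract, verbatim): «discharging `BetaPertH` makes Bałaban's UV stability UNCONDITIONAL —
a real constructive-QFT result; it is NOT the continuum limit and NOT the Clay problem.»  ABSOLUTE RULE (cell charter, verbatim): «No internally-minted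
statement may enter as a cited fact. Every hypothesis is either kernel-proved in this package or a verbatim quotation of a PUBLISHED theorem with page
reference. The manuscript(s) under audit are NOT citable for their own disputed steps — they are the thing under adjudication; programme-internal
(2001/route/tribunal) claims are never citable.»  Row D1 ∕ (C1) OWNER «beta-an2», b2b-balaban-beta-an2 gen 82, 2026-08-29.  No existing file touched.
-/

noncomputable section

open Finset Matrix
open scoped BigOperators
open Literature.MathematicalPhysics.QuantumFieldTheory
open Literature.MathematicalPhysics.QuantumFieldTheory.Balaban1983to89
open Literature.MathematicalPhysics.QuantumFieldTheory.Balaban1983to89.Beta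
open Literature.MathematicalPhysics.QuantumFieldTheory.Balaban1983to89.B12Sec2to5 (l1 l1_nonneg)
open B5Prop11Plancherel (fine)
open B6Lemma24Torus (pbox mem_pbox)
open AffineAveraging (Site box toSite unitVec)
open OneStepResolventKernel (Fib)
open ExpKernelCalculus (MKer Decays l1_sub_triangle l1_sub_symm Zl Zl_nonneg summable_exp_shift summable_exp_shift' tsum_exp_shift')
open HessKerRate (scaleK decays_scaleK)
open Literature.MathematicalPhysics.QuantumFieldTheory.LatticeForm (quo)
open Summit.QuantumFields.BalabanUV.Beta.CompositeOneShotJetData (Roots AN)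
open Summit.QuantumFields.BalabanUV.Beta.NVertexSectors (decays_AN)
open Summit.QuantumFields.BalabanUV.Beta.FP.TorusCombRows (Res)
open Summit.QuantumFields.BalabanUV.Beta.FP.TorusCompositeObjects (towerTorus NParam combF bigP towerGen bigRoot bigRatio bigRatio_eq_pow bigRatio_pos towerEquiv)
open Summit.QuantumFields.BalabanUV.Beta.FP.TorusCompositeObjectsG (StepRows)
open Summit.QuantumFields.BalabanUV.Beta.FP.TorusCompositeUnimodular (towerEvalC)
open Summit.QuantumFields.BalabanUV.Beta.FP.TorusReferenceBlock (towerTorus_ref_apply sub_zsmul_quo_mem_pbox_ref)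
open Summit.QuantumFields.BalabanUV.Beta.FP.TowerDoorGaugeRefDefs (refCol refCol_apply)
open Summit.QuantumFields.BalabanUV.Beta.FP.TowerDoorGaugeRefDefsG
open Summit.QuantumFields.BalabanUV.Beta.FP.TowerDoorGaugeBound (abs_mulVec_apply_le abs_readout_mulVec_le l1_sub_le_of_mem_pbox l1_zsmul_sub_le decays_scaleK_AN)

namespace Summit.QuantumFields.BalabanUV.Beta.FP.TowerDoorGaugeBoundG

variable {d : ℕ}


/-! ## §1 The lattice gauge function over `Q` is bounded by the column, and exponentially localised for a decaying chart -/

section LamZ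

variable (Lc : ℕ) [NeZero Lc] (Q : StepRows d Lc) (lev : ℕ → ℕ) (rs : ℕ → (Fin (d + 1) → ℕ))
  (hrs : ∀ k i, 0 ≤ toSite (rs k) i ∧ toSite (rs k) i < (Lc : ℤ)) (n : ℕ)

/-- [folklore] **`exists_abs_lamZG_le_sum`** — `|lamZ … A μ z u| ≤ K · Σ_b |A ↑b.1 (L•(z − quo L u)) (inl b.2) (inr μ)|` with ONE constant `K ≥ 0` for all kernels, legs, sources and sites (the entry sum of
`towerEvalC · (−((refSlice·towerGen)⁻¹ · refSlice))` read at the residual slots — OUR finite reference matrices; no size claimed). -/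
theorem exists_abs_lamZG_le_sum : ∃ K : ℝ, 0 ≤ K ∧ ∀ (A : MKer (d + 1) (Fib d)) (μ : Fin (d + 1)) (z u : Site (d + 1)),
    |lamZG Lc Q lev rs hrs n A μ z u|
      ≤ K * ∑ b : ↥(pbox (towerTorus Lc (fun _ : Fin (d + 1) => Lc) (n + 1))) × Fin (d + 1),
          |A (b.1 : Site (d + 1)) (((bigRatio Lc (n + 1) : ℕ) : ℤ) • (z - quo (bigRatio Lc (n + 1)) u)) (Sum.inl b.2) (Sum.inr μ)| := by
  set M : Matrix (NParam Lc (fun _ : Fin (d + 1) => Lc) rs (n + 1)) (↥(pbox (towerTorus Lc (fun _ : Fin (d + 1) => Lc) (n + 1))) × Fin (d + 1)) ℝ :=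
    towerEvalC Lc (fun _ : Fin (d + 1) => Lc) rs hrs (n + 1)
      * -((refSliceG Lc Q lev rs hrs n * towerGen Lc (fun _ : Fin (d + 1) => Lc) rs (n + 1))⁻¹ * refSliceG Lc Q lev rs hrs n) with hM
  refine ⟨∑ x : Res (bigRoot Lc rs (n + 1)) (bigRatio Lc (n + 1)) (towerTorus Lc (fun _ : Fin (d + 1) => Lc) (n + 1)),
      ∑ b, |M (towerEquiv Lc (fun _ : Fin (d + 1) => Lc) rs hrs (n + 1) x) b|,
    Finset.sum_nonneg fun x _ => Finset.sum_nonneg fun b _ => abs_nonneg _, fun A μ z u => ?_⟩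
  have e : towerEvalC Lc (fun _ : Fin (d + 1) => Lc) rs hrs (n + 1) *ᵥ refThetaG Lc Q lev rs hrs n A μ (z - quo (bigRatio Lc (n + 1)) u)
      = M *ᵥ refCol Lc n A μ (z - quo (bigRatio Lc (n + 1)) u) := by
    rw [refThetaG_eq, hM, ← Matrix.mulVec_mulVec, Matrix.neg_mulVec, ← Matrix.mulVec_mulVec]
  rw [lamZG_eq, abs_neg, e]
  exact abs_readout_mulVec_le M _ _ _ _

/-- [folklore] **`exists_abs_lamZG_le_exp` — EXPONENTIAL LOCALISATION AT THE SOURCE BLOCK**: for a `δ`-decaying kernel (`Decays A C δ`, `0 ≤ δ`), `∃ K ≥ 0, ∀ μ z u,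
|lamZ … A μ z u| ≤ K · exp (−δ · |L•z − u|₁)` (every reference bond `p` and the representative `r = u − L•quo L u` lie in the one-block box `[0,L)^{d+1}`: `|p − L•(z − quo L u)|₁ ≥ |L•z − u|₁ − (d+1)·L`). -/
theorem exists_abs_lamZG_le_exp {A : MKer (d + 1) (Fib d)} {C δ : ℝ} (hA : Decays A C δ) (hδ : 0 ≤ δ) :
    ∃ K : ℝ, 0 ≤ K ∧ ∀ (μ : Fin (d + 1)) (z u : Site (d + 1)),
      |lamZG Lc Q lev rs hrs n A μ z u| ≤ K * Real.exp (-δ * l1 ((((bigRatio Lc (n + 1) : ℕ) : ℤ) • z) - u)) := by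
  obtain ⟨K, hK, h⟩ := exists_abs_lamZG_le_sum Lc Q lev rs hrs n
  have hC : 0 ≤ C := hA.nonneg (Sum.inl 0)
  set L : ℕ := bigRatio Lc (n + 1) with hL
  set D₀ : ℝ := ∑ i : Fin (d + 1), (towerTorus Lc (fun _ : Fin (d + 1) => Lc) (n + 1) i : ℝ) with hD₀
  refine ⟨K * ((Fintype.card (↥(pbox (towerTorus Lc (fun _ : Fin (d + 1) => Lc) (n + 1))) × Fin (d + 1)) : ℝ) * (C * Real.exp (δ * D₀))),
    mul_nonneg hK (mul_nonneg (Nat.cast_nonneg _) (mul_nonneg hC (Real.exp_pos _).le)), fun μ z u => ?_⟩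
  refine (h A μ z u).trans ?_
  rw [mul_assoc]
  refine mul_le_mul_of_nonneg_left ?_ hK
  -- each bond's entry is bounded by `C·e^{δ D₀}·e^{−δ |L•z − u|₁}`
  have hb : ∀ b : ↥(pbox (towerTorus Lc (fun _ : Fin (d + 1) => Lc) (n + 1))) × Fin (d + 1),
      |A (b.1 : Site (d + 1)) (((L : ℕ) : ℤ) • (z - quo L u)) (Sum.inl b.2) (Sum.inr μ)|
        ≤ C * Real.exp (δ * D₀) * Real.exp (-δ * l1 ((((L : ℕ) : ℤ) • z) - u)) := by
    intro b
    refine (hA _ _ _ _).trans ?_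
    rw [mul_assoc, ← Real.exp_add]
    refine mul_le_mul_of_nonneg_left (Real.exp_le_exp.mpr ?_) hC
    have ht := l1_zsmul_sub_le (((L : ℕ) : ℤ)) z (quo L u) u (b.1 : Site (d + 1))
    have hD : l1 ((b.1 : Site (d + 1)) - (u + (((L : ℕ) : ℤ)) • (-quo L u))) ≤ D₀ :=
      l1_sub_le_of_mem_pbox b.1.2 (sub_zsmul_quo_mem_pbox_ref Lc n u)
    nlinarith [l1_nonneg ((b.1 : Site (d + 1)) - (((L : ℕ) : ℤ)) • (z - quo L u)), l1_nonneg ((((L : ℕ) : ℤ) • z) - u)]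
  refine (Finset.sum_le_sum fun b _ => hb b).trans ?_
  rw [Finset.sum_const, nsmul_eq_mul, Finset.card_univ]
  exact le_of_eq (by ring)

/-- [folklore] … hence `λℤ` is UNIFORMLY BOUNDED. -/
theorem exists_abs_lamZG_le {A : MKer (d + 1) (Fib d)} {C δ : ℝ} (hA : Decays A C δ) (hδ : 0 ≤ δ) :
    ∃ K : ℝ, 0 ≤ K ∧ ∀ (μ : Fin (d + 1)) (z u : Site (d + 1)), |lamZG Lc Q lev rs hrs n A μ z u| ≤ K := by
  obtain ⟨K, hK, h⟩ := exists_abs_lamZG_le_exp Lc Q lev rs hrs n hA hδ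
  refine ⟨K, hK, fun μ z u => (h μ z u).trans ?_⟩
  have : Real.exp (-δ * l1 ((((bigRatio Lc (n + 1) : ℕ) : ℤ) • z) - u)) ≤ 1 :=
    Real.exp_le_one_iff.mpr (by nlinarith [l1_nonneg ((((bigRatio Lc (n + 1) : ℕ) : ℤ) • z) - u)])
  nlinarith

/-- [folklore] **`summable_abs_lamZG_sites`** — `λℤ_(μ,z)` is absolutely summable over the lattice sites (`0 < δ`; lit `summable_exp_shift`). -/
theorem summable_abs_lamZG_sites {A : MKer (d + 1) (Fib d)} {C δ : ℝ} (hA : Decays A C δ) (hδ : 0 < δ) (μ : Fin (d + 1)) (z : Site (d + 1)) :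
    Summable (fun u : Site (d + 1) => |lamZG Lc Q lev rs hrs n A μ z u|) := by
  obtain ⟨K, hK, h⟩ := exists_abs_lamZG_le_exp Lc Q lev rs hrs n hA hδ.le
  refine Summable.of_nonneg_of_le (fun u => abs_nonneg _) (fun u => h μ z u) ?_
  exact (summable_exp_shift hδ ((((bigRatio Lc (n + 1) : ℕ) : ℤ) • z))).mul_left K

/-- [folklore] **`summable_abs_lamZG_sources`** — `z ↦ λℤ_(μ,z)(u)` is absolutely summable over the sources (`0 < δ`; the source map `z ↦ L•z` is injective, lit `summable_exp_shift'`). -/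
theorem summable_abs_lamZG_sources {A : MKer (d + 1) (Fib d)} {C δ : ℝ} (hA : Decays A C δ) (hδ : 0 < δ) (μ : Fin (d + 1)) (u : Site (d + 1)) :
    Summable (fun z : Site (d + 1) => |lamZG Lc Q lev rs hrs n A μ z u|) := by
  obtain ⟨K, hK, h⟩ := exists_abs_lamZG_le_exp Lc Q lev rs hrs n hA hδ.le
  have hL : (((bigRatio Lc (n + 1) : ℕ) : ℤ)) ≠ 0 := by exact_mod_cast (bigRatio_pos Lc (Nat.pos_of_ne_zero (NeZero.ne Lc)) (n + 1)).ne'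
  have hinj : Function.Injective (fun z : Site (d + 1) => (((bigRatio Lc (n + 1) : ℕ) : ℤ)) • z) := smul_right_injective _ hL
  refine Summable.of_nonneg_of_le (fun z => abs_nonneg _) (fun z => h μ z u) ?_
  exact (((summable_exp_shift' hδ u).comp_injective hinj)).mul_left K

/-- [folklore] **`exists_tsum_abs_lamZG_sources_le`** — the source sum of `|λℤ|` is bounded UNIFORMLY in the site: `∃ B, ∀ μ u, Σ'_z |lamZ … A μ z u| ≤ B` (`0 < δ`; a sub-series of the lattice constant `Zl δ`). -/
theorem exists_tsum_abs_lamZG_sources_le {A : MKer (d + 1) (Fib d)} {C δ : ℝ} (hA : Decays A C δ) (hδ : 0 < δ) :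
    ∃ B : ℝ, 0 ≤ B ∧ ∀ (μ : Fin (d + 1)) (u : Site (d + 1)), (∑' z : Site (d + 1), |lamZG Lc Q lev rs hrs n A μ z u|) ≤ B := by
  obtain ⟨K, hK, h⟩ := exists_abs_lamZG_le_exp Lc Q lev rs hrs n hA hδ.le
  have hL : (((bigRatio Lc (n + 1) : ℕ) : ℤ)) ≠ 0 := by exact_mod_cast (bigRatio_pos Lc (Nat.pos_of_ne_zero (NeZero.ne Lc)) (n + 1)).ne'
  have hinj : Function.Injective (fun z : Site (d + 1) => (((bigRatio Lc (n + 1) : ℕ) : ℤ)) • z) := smul_right_injective _ hL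
  refine ⟨K * Zl (d + 1) δ, mul_nonneg hK (Zl_nonneg hδ), fun μ u => ?_⟩
  have hs : Summable (fun z : Site (d + 1) => Real.exp (-δ * l1 ((((bigRatio Lc (n + 1) : ℕ) : ℤ) • z) - u))) :=
    (summable_exp_shift' hδ u).comp_injective hinj
  have h1 : (∑' z : Site (d + 1), |lamZG Lc Q lev rs hrs n A μ z u|) ≤ ∑' z : Site (d + 1), K * Real.exp (-δ * l1 ((((bigRatio Lc (n + 1) : ℕ) : ℤ) • z) - u)) :=
    (Summable.of_nonneg_of_le (fun z => abs_nonneg _) (fun z => h μ z u) (hs.mul_left K)).tsum_le_tsum (fun z => h μ z u) (hs.mul_left K)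
  refine h1.trans ?_
  rw [tsum_mul_left]
  refine mul_le_mul_of_nonneg_left ?_ hK
  rw [← tsum_exp_shift' (c := δ) u]
  exact tsum_comp_le_tsum_of_inj (summable_exp_shift' hδ u) (fun y => (Real.exp_pos _).le) hinj

end LamZ

/-! ## §2 The record's chart `σ·AN·σ`, over `Q` -/

section Record

variable {Lc : ℕ} [NeZero Lc] (Q : StepRows 3 Lc) (R : Roots Lc) (lev : ℕ → ℕ) (rs : ℕ → (Fin (3 + 1) → ℕ))
  (hrs : ∀ k i, 0 ≤ toSite (rs k) i ∧ toSite (rs k) i < (Lc : ℤ)) (n : ℕ) (σ : Fib 3 → ℝ)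

/-- [folklore] **`exists_abs_lamZG_record_le_exp` — THE RECORD's `λℤ` IS EXPONENTIALLY LOCALISED AT THE SOURCE BLOCK**, hypothesis-free:
`∃ δ > 0, ∃ K ≥ 0, ∀ μ z u, |lamZG Lc Q lev rs hrs n (scaleK σ σ (AN R (n+1))) μ z u| ≤ K · exp (−δ · |L•z − u|₁)`. -/
theorem exists_abs_lamZG_record_le_exp : ∃ δ : ℝ, 0 < δ ∧ ∃ K : ℝ, 0 ≤ K ∧ ∀ (μ : Fin (3 + 1)) (z u : Site (3 + 1)),
    |lamZG Lc Q lev rs hrs n (scaleK σ σ (AN R (n + 1))) μ z u| ≤ K * Real.exp (-δ * l1 ((((bigRatio Lc (n + 1) : ℕ) : ℤ) • z) - u)) := by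
  obtain ⟨δ, C, hδ, _, hA⟩ := decays_scaleK_AN R σ (n + 1)
  exact ⟨δ, hδ, exists_abs_lamZG_le_exp Lc Q lev rs hrs n hA hδ.le⟩

/-- [folklore] the record's `λℤ_(μ,z)` is absolutely summable over the sites. -/
theorem summable_abs_lamZG_record_sites (μ : Fin (3 + 1)) (z : Site (3 + 1)) :
    Summable (fun u : Site (3 + 1) => |lamZG Lc Q lev rs hrs n (scaleK σ σ (AN R (n + 1))) μ z u|) := by
  obtain ⟨δ, C, hδ, _, hA⟩ := decays_scaleK_AN R σ (n + 1)
  exact summable_abs_lamZG_sites Lc Q lev rs hrs n hA hδ μ z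

/-- [folklore] the record's `z ↦ λℤ_(μ,z)(u)` is absolutely summable over the sources. -/
theorem summable_abs_lamZG_record_sources (μ : Fin (3 + 1)) (u : Site (3 + 1)) :
    Summable (fun z : Site (3 + 1) => |lamZG Lc Q lev rs hrs n (scaleK σ σ (AN R (n + 1))) μ z u|) := by
  obtain ⟨δ, C, hδ, _, hA⟩ := decays_scaleK_AN R σ (n + 1)
  exact summable_abs_lamZG_sources Lc Q lev rs hrs n hA hδ μ u

/-- [folklore] the record's source sum of `|λℤ|` is bounded uniformly in the site. -/
theorem exists_tsum_abs_lamZG_record_sources_le : ∃ B : ℝ, 0 ≤ B ∧ ∀ (μ : Fin (3 + 1)) (u : Site (3 + 1)),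
    (∑' z : Site (3 + 1), |lamZG Lc Q lev rs hrs n (scaleK σ σ (AN R (n + 1))) μ z u|) ≤ B := by
  obtain ⟨δ, C, hδ, _, hA⟩ := decays_scaleK_AN R σ (n + 1)
  exact exists_tsum_abs_lamZG_sources_le Lc Q lev rs hrs n hA hδ

end Record

end Summit.QuantumFields.BalabanUV.Beta.FP.TowerDoorGaugeBoundG

end
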